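import Literature.NumberTheory.Automorphic.Liu2021.Def411WeilCarriersDoublingSum
import Literature.NumberTheory.GelbartRogawski1991.UnitaryDualPairSeesawCharacterLeft
import Literature.NumberTheory.GelbartRogawski1991.UnitaryDualPairWeilCoinvariants
import HarnessLib

/-!
# The central coinvariants of the finite Weil representation along EQUAL V-side Gram data, and the cast
# `diagonal (dV₁ ‖ dV₂)` ↔ `finSum (diagonal dV₁) (diagonal dV₂)` at the χ-attached splittings of a line

A V-side Gram datum can be presented by two propositionally equal matrices — e.g. the diagonal matrix of a concatenated vector
`diag (dV₁ ‖ dV₂)` and the orthogonal sum `diag dV₁ ⊕ᶠ diag dV₂` (`finSum_diagonal_append`); the metaplectic carriers depend on the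
matrices, so the compatible splittings and the finite Weil representations live in different types and are related by the transport
`splittingCongrV` (`Def411WeilCarriersDoublingSum`).  This file descends that transport to the central coinvariants
([GelbartRogawski1991, Remark p. 457]: the maximal `χ`-quotient is functorial; [MoeglinVignerasWaldspurger1987, Chap. 2 II.1]: transport of
structure along equal data is the identity):

* §1 GENERIC (any `N M`, any compatible `s` at `(T_V, J_V)`): `finAdelicCastV hJ : U(J_V)(𝔸_f) ≃* U(J_V′)(𝔸_f)` along `J_V = J_V′`
  (same matrices), `weilCoinvCongrV hT hJ … : Coinv (ω_f(s)|_{U(W)}) χ ≃ₗ[ℂ] Coinv (ω_f(splittingCongrV hT hJ s)|_{U(W)}) χ` (by `subst`,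
  the identity), `_mk`, and its equivariance `weilCoinvCongrV_weilCoinv`.
* §2 THE INSTANCE at the χ-attached splittings of a line ([Liu2021, App. D §D.1 Steps 1–3]): `appendCoinvEquiv` from the datum
  `diagonal (Fin.append dV₁ dV₂)` with `chiSplittingLine` to the datum `finSum (diagonal dV₁) (diagonal dV₂)` with `chiSplittingSum`
  (proof arguments `isSymm_finSum`, `isUnit_det_finSum_realDiagonal`, `finSum_eq_map_finSum` as in
  `UnitaryDualPairFaceSplitCoinvariants`), `_mk`, `appendCoinvEquiv_weilCoinv`.

Definitions with bodies + theorems only; no named fact, no instance, no `sorry`.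

## References
* [GelbartRogawski1991] S. Gelbart, J. Rogawski, Invent. Math. 105 (1991), §3.1 Prop. 3.1.1 p. 455, Remark p. 457.
* [MoeglinVignerasWaldspurger1987] C. Mœglin, M.-F. Vignéras, J.-L. Waldspurger, LNM 1291 (1987), Chap. 2 II.1.
* [Kudla1984] S. Kudla, *Seesaw dual reductive pairs*, Progr. Math. 46 (1984), §1.
* [Liu2021] Y. Liu, Camb. J. Math. 9 (2021) = arXiv:2102.11518, App. D §D.1 Steps 1–3 (l. 5217–5219).
-/

set_option autoImplicit false

noncomputable section

open scoped Matrix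
open NumberField
open Literature.NumberTheory.Weil1964 Literature.NumberTheory.Automorphic Literature.NumberTheory.Automorphic.UnitaryGroup
open Literature.NumberTheory.GelbartRogawski1991 Literature.NumberTheory.GelbartRogawski1991.UnitaryDualPair
open Literature.NumberTheory.GelbartRogawski1991.UnitaryDualPair.WeilCoinv
open Literature.NumberTheory.GelbartRogawski1991.GRConstruction
open Literature.RepresentationTheory.HarrisKudlaSweet1996
open Literature.NumberTheory.GaloisRepresentations
open Literature.RepresentationTheory

namespace Literature.NumberTheory.Automorphic.Liu2021.Def411WeilCarriersDoubling

/-! ## §1  GENERIC: the central coinvariants transported along EQUAL V-side Gram data (the identity) -/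

section CoinvCongrV

variable (F E : Type) [Field F] [NumberField F] [Field E] [NumberField E] [Algebra F E]
variable (c : E ≃ₐ[F] E) (N M : ℕ) {n : ℕ} (e : Fin N × Fin M ≃ Fin n)
variable {JV JV' : Matrix (Fin N) (Fin N) E} {TV TV' : Matrix (Fin N) (Fin N) F}
variable (JW : Matrix (Fin M) (Fin M) E) {TW : Matrix (Fin M) (Fin M) F}

/-- **the group cast `U(J_V)(𝔸_{F,f}) ≃* U(J_V′)(𝔸_{F,f})` along `J_V = J_V′`** (same underlying matrices). [cite: MoeglinVignerasWaldspurger1987, Chap. 2 II.1] -/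
def finAdelicCastV (hJ : JV = JV') : finAdelic F E c N JV ≃* finAdelic F E c N JV' :=
  MulEquiv.subgroupCongr (by rw [hJ])

omit [NumberField F] in
/-- the cast does not move the underlying matrix. [cite: MoeglinVignerasWaldspurger1987, Chap. 2 II.1] -/
@[simp] theorem coe_finAdelicCastV (hJ : JV = JV') (k : finAdelic F E c N JV) :
    ((finAdelicCastV F E c N hJ k : finAdelic F E c N JV') : GL (Fin N) (IsDedekindDomain.FiniteAdeleRing (𝓞 E) E)) =
      (k : GL (Fin N) (IsDedekindDomain.FiniteAdeleRing (𝓞 E) E)) := by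
  subst hJ
  rfl

variable [Algebra.IsQuadraticExtension F E] {δ : E} (hcδ : c δ = -δ) (hδ : δ ≠ 0) {d : F} (hd : δ * δ = algebraMap F E d)
  (hW : TW.IsSymm) (hWd : IsUnit TW.det) (hJW : JW = TW.map (algebraMap F E))

/-- **the central coinvariants transported along equal V-side Gram data**: for `hT : T_V = T_V′`, `hJ : J_V = J_V′` and a compatible
splitting `s` at `(T_V, J_V)`, `Coinv (ω_f(s)|_{U(W)}) χ ≃ₗ[ℂ] Coinv (ω_f(splittingCongrV hT hJ s)|_{U(W)}) χ` — the identity after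
`subst` (the proof arguments of the target datum are arbitrary, by proof irrelevance). [cite: MoeglinVignerasWaldspurger1987, Chap. 2 II.1] -/
def weilCoinvCongrV (hT : TV = TV') (hJ : JV = JV') (hV : TV.IsSymm) (hV' : TV'.IsSymm) (hVd : IsUnit TV.det) (hVd' : IsUnit TV'.det)
    (hJV : JV = TV.map (algebraMap F E)) (hJV' : JV' = TV'.map (algebraMap F E))
    {s : UnitaryGroup.adelicPair F E c N M JV JW →* adelicMpCont F (Fin n) (adelicGram F e TV TW)}
    (hs : (splittingDatum F E c N M e JV JW hcδ hδ hd hV hW hVd hWd hJV hJW).IsCompatible s)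
    (hs' : (splittingDatum F E c N M e JV' JW hcδ hδ hd hV' hW hVd' hWd hJV' hJW).IsCompatible (splittingCongrV F E c N M e JW hT hJ s))
    (χ : finAdelic F E c M JW →* ℂˣ) :
    TwistedCoinv.Coinv (finPairRepW F E c N M e JV JW hcδ hδ hd hV hW hVd hWd hJV hJW hs) χ ≃ₗ[ℂ]
      TwistedCoinv.Coinv (finPairRepW F E c N M e JV' JW hcδ hδ hd hV' hW hVd' hWd hJV' hJW hs') χ := by
  subst hT hJ
  exact LinearEquiv.refl ℂ _

/-- `weilCoinvCongrV` is the identity on classes. [cite: MoeglinVignerasWaldspurger1987, Chap. 2 II.1] -/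
theorem weilCoinvCongrV_mk (hT : TV = TV') (hJ : JV = JV') (hV : TV.IsSymm) (hV' : TV'.IsSymm) (hVd : IsUnit TV.det)
    (hVd' : IsUnit TV'.det) (hJV : JV = TV.map (algebraMap F E)) (hJV' : JV' = TV'.map (algebraMap F E))
    {s : UnitaryGroup.adelicPair F E c N M JV JW →* adelicMpCont F (Fin n) (adelicGram F e TV TW)}
    (hs : (splittingDatum F E c N M e JV JW hcδ hδ hd hV hW hVd hWd hJV hJW).IsCompatible s)
    (hs' : (splittingDatum F E c N M e JV' JW hcδ hδ hd hV' hW hVd' hWd hJV' hJW).IsCompatible (splittingCongrV F E c N M e JW hT hJ s))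
    (χ : finAdelic F E c M JW →* ℂˣ) (f : FinSB F (Fin N × Fin M)) :
    weilCoinvCongrV F E c N M e JW hcδ hδ hd hW hWd hJW hT hJ hV hV' hVd hVd' hJV hJV' hs hs' χ (TwistedCoinv.mk _ χ f) =
      TwistedCoinv.mk _ χ f := by
  subst hT hJ
  rfl

/-- **equivariance of the cast**: `weilCoinvCongrV` intertwines `weilCoinv(s, χ)(k)` with `weilCoinv(splittingCongrV s, χ)(cast k)`.
[cite: MoeglinVignerasWaldspurger1987, Chap. 2 II.1] -/
theorem weilCoinvCongrV_weilCoinv (hT : TV = TV') (hJ : JV = JV') (hV : TV.IsSymm) (hV' : TV'.IsSymm) (hVd : IsUnit TV.det)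
    (hVd' : IsUnit TV'.det) (hJV : JV = TV.map (algebraMap F E)) (hJV' : JV' = TV'.map (algebraMap F E))
    {s : UnitaryGroup.adelicPair F E c N M JV JW →* adelicMpCont F (Fin n) (adelicGram F e TV TW)}
    (hs : (splittingDatum F E c N M e JV JW hcδ hδ hd hV hW hVd hWd hJV hJW).IsCompatible s)
    (hs' : (splittingDatum F E c N M e JV' JW hcδ hδ hd hV' hW hVd' hWd hJV' hJW).IsCompatible (splittingCongrV F E c N M e JW hT hJ s))
    (χ : finAdelic F E c M JW →* ℂˣ) (k : finAdelic F E c N JV)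
    (x : TwistedCoinv.Coinv (finPairRepW F E c N M e JV JW hcδ hδ hd hV hW hVd hWd hJV hJW hs) χ) :
    weilCoinvCongrV F E c N M e JW hcδ hδ hd hW hWd hJW hT hJ hV hV' hVd hVd' hJV hJV' hs hs' χ
        (weilCoinv F E c N M e JV JW hcδ hδ hd hV hW hVd hWd hJV hJW χ hs k x) =
      weilCoinv F E c N M e JV' JW hcδ hδ hd hV' hW hVd' hWd hJV' hJW χ hs' (finAdelicCastV F E c N hJ k)
        (weilCoinvCongrV F E c N M e JW hcδ hδ hd hW hWd hJW hT hJ hV hV' hVd hVd' hJV hJV' hs hs' χ x) := by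
  subst hT hJ
  rfl

end CoinvCongrV

/-! ## §2  THE INSTANCE: `diagonal (dV₁ ‖ dV₂)` ↔ `finSum (diagonal dV₁) (diagonal dV₂)` at the χ-splittings of a line -/

section AppendInstance

variable (L : Type) [Field L] [NumberField L] [IsCMField L] {N₁ N₂ n : ℕ} (eV : Fin (N₁ + N₂) × Fin 1 ≃ Fin n)
  (dV₁ : Fin N₁ → L) (hdV₁ : ∀ i, IsCMField.complexConj L (dV₁ i) = dV₁ i) (hdV₁0 : ∀ i, dV₁ i ≠ 0)
  (dV₂ : Fin N₂ → L) (hdV₂ : ∀ i, IsCMField.complexConj L (dV₂ i) = dV₂ i) (hdV₂0 : ∀ i, dV₂ i ≠ 0)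
  (χ : HeckeCharacter L) (hχu : χ.IsUnitary) (hχs : IsSplittingChar L 1 χ)
  (TW : Matrix (Fin 1) (Fin 1) (Fp L)) (hW : TW.IsSymm) (hWd : IsUnit TW.det) (JW : Matrix (Fin 1) (Fin 1) L)
  (hJW : JW = TW.map (algebraMap (Fp L) L)) (χW : finAdelic (Fp L) L (IsCMField.complexConj L) 1 JW →* ℂˣ)

/-- **THE APPEND/FIN-SUM CAST on the central coinvariants**: `Coinv (ω_f(s_χ[diag (dV₁ ‖ dV₂)])|_{U(W)}) χ_W ≃ₗ[ℂ]
Coinv (ω_f(chiSplittingSum)|_{U(W)}) χ_W`, the latter at the datum `finSum (diagonal dV₁) (diagonal dV₂)` with the proof arguments of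
`UnitaryDualPairFaceSplitCoinvariants` (`isSymm_finSum`, `isUnit_det_finSum_realDiagonal`, `finSum_eq_map_finSum`).
[cite: Liu2021, App. D §D.1 Steps 1–2 (l. 5217–5219)] [cite: Kudla1984, §1] -/
def appendCoinvEquiv :
    TwistedCoinv.Coinv
        (finPairRepW (Fp L) L (IsCMField.complexConj L) (N₁ + N₂) 1 eV (Matrix.diagonal (Fin.append dV₁ dV₂)) JW
          (complexConj_imagUnit L) (imagUnit_ne_zero L) (imagUnit_mul_self L)
          (realDiagonal_isSymm L _ (complexConj_append L dV₁ dV₂ hdV₁ hdV₂)) hW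
          (isUnit_det_realDiagonal L _ (complexConj_append L dV₁ dV₂ hdV₁ hdV₂) (append_ne_zero dV₁ dV₂ hdV₁0 hdV₂0)) hWd
          (realDiagonal_map L _ (complexConj_append L dV₁ dV₂ hdV₁ hdV₂)).symm hJW
          (isCompatible_chiSplittingLine L eV (Fin.append dV₁ dV₂) (complexConj_append L dV₁ dV₂ hdV₁ hdV₂)
            (append_ne_zero dV₁ dV₂ hdV₁0 hdV₂0) χ hχu hχs TW hW hWd JW hJW)) χW ≃ₗ[ℂ]
      TwistedCoinv.Coinv
        (finPairRepW (Fp L) L (IsCMField.complexConj L) (N₁ + N₂) 1 eV (finSum N₁ N₂ (Matrix.diagonal dV₁) (Matrix.diagonal dV₂)) JW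
          (complexConj_imagUnit L) (imagUnit_ne_zero L) (imagUnit_mul_self L)
          (isSymm_finSum (realDiagonal_isSymm L dV₁ hdV₁) (realDiagonal_isSymm L dV₂ hdV₂)) hW
          (isUnit_det_finSum_realDiagonal L dV₁ dV₂ hdV₁ hdV₂ hdV₁0 hdV₂0) hWd
          (finSum_eq_map_finSum (Fp L) L N₁ N₂ (Matrix.diagonal dV₁) (Matrix.diagonal dV₂) (realDiagonal_map L dV₁ hdV₁).symm
            (realDiagonal_map L dV₂ hdV₂).symm) hJW
          (isCompatible_chiSplittingSum L eV dV₁ hdV₁ hdV₁0 dV₂ hdV₂ hdV₂0 χ hχu hχs TW hW hWd JW hJW _ _ _)) χW :=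
  weilCoinvCongrV (Fp L) L (IsCMField.complexConj L) (N₁ + N₂) 1 eV JW (complexConj_imagUnit L) (imagUnit_ne_zero L)
    (imagUnit_mul_self L) hW hWd hJW (finSum_realDiagonal_append L dV₁ dV₂ hdV₁ hdV₂).symm (finSum_diagonal_append dV₁ dV₂).symm
    _ _ _ _ _ _ _ _ χW

/-- `appendCoinvEquiv (mk f) = mk f`. [cite: Liu2021, App. D §D.1 Step 3 (l. 5221)] -/
theorem appendCoinvEquiv_mk (f : FinSB (Fp L) (Fin (N₁ + N₂) × Fin 1)) :
    appendCoinvEquiv L eV dV₁ hdV₁ hdV₁0 dV₂ hdV₂ hdV₂0 χ hχu hχs TW hW hWd JW hJW χW (TwistedCoinv.mk _ χW f) =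
      TwistedCoinv.mk _ χW f :=
  weilCoinvCongrV_mk (Fp L) L (IsCMField.complexConj L) (N₁ + N₂) 1 eV JW (complexConj_imagUnit L) (imagUnit_ne_zero L)
    (imagUnit_mul_self L) hW hWd hJW _ _ _ _ _ _ _ _ _ _ χW f

/-- **equivariance of the append/fin-sum cast** along the group cast `finAdelicCastV (finSum_diagonal_append …).symm :
U(diag (dV₁ ‖ dV₂))(𝔸_f) ≃* U(diag dV₁ ⊕ᶠ diag dV₂)(𝔸_f)` (same matrices). [cite: Liu2021, App. D §D.1 Step 3 (l. 5221)] [cite: Kudla1984, §1] -/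
theorem appendCoinvEquiv_weilCoinv (k : finAdelic (Fp L) L (IsCMField.complexConj L) (N₁ + N₂) (Matrix.diagonal (Fin.append dV₁ dV₂)))
    (x : TwistedCoinv.Coinv
      (finPairRepW (Fp L) L (IsCMField.complexConj L) (N₁ + N₂) 1 eV (Matrix.diagonal (Fin.append dV₁ dV₂)) JW
        (complexConj_imagUnit L) (imagUnit_ne_zero L) (imagUnit_mul_self L)
        (realDiagonal_isSymm L _ (complexConj_append L dV₁ dV₂ hdV₁ hdV₂)) hW
        (isUnit_det_realDiagonal L _ (complexConj_append L dV₁ dV₂ hdV₁ hdV₂) (append_ne_zero dV₁ dV₂ hdV₁0 hdV₂0)) hWd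
        (realDiagonal_map L _ (complexConj_append L dV₁ dV₂ hdV₁ hdV₂)).symm hJW
        (isCompatible_chiSplittingLine L eV (Fin.append dV₁ dV₂) (complexConj_append L dV₁ dV₂ hdV₁ hdV₂)
          (append_ne_zero dV₁ dV₂ hdV₁0 hdV₂0) χ hχu hχs TW hW hWd JW hJW)) χW) :
    appendCoinvEquiv L eV dV₁ hdV₁ hdV₁0 dV₂ hdV₂ hdV₂0 χ hχu hχs TW hW hWd JW hJW χW
        (weilCoinv (Fp L) L (IsCMField.complexConj L) (N₁ + N₂) 1 eV (Matrix.diagonal (Fin.append dV₁ dV₂)) JW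
          (complexConj_imagUnit L) (imagUnit_ne_zero L) (imagUnit_mul_self L)
          (realDiagonal_isSymm L _ (complexConj_append L dV₁ dV₂ hdV₁ hdV₂)) hW
          (isUnit_det_realDiagonal L _ (complexConj_append L dV₁ dV₂ hdV₁ hdV₂) (append_ne_zero dV₁ dV₂ hdV₁0 hdV₂0)) hWd
          (realDiagonal_map L _ (complexConj_append L dV₁ dV₂ hdV₁ hdV₂)).symm hJW χW
          (isCompatible_chiSplittingLine L eV (Fin.append dV₁ dV₂) (complexConj_append L dV₁ dV₂ hdV₁ hdV₂)
            (append_ne_zero dV₁ dV₂ hdV₁0 hdV₂0) χ hχu hχs TW hW hWd JW hJW) k x) =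
      weilCoinv (Fp L) L (IsCMField.complexConj L) (N₁ + N₂) 1 eV (finSum N₁ N₂ (Matrix.diagonal dV₁) (Matrix.diagonal dV₂)) JW
          (complexConj_imagUnit L) (imagUnit_ne_zero L) (imagUnit_mul_self L)
          (isSymm_finSum (realDiagonal_isSymm L dV₁ hdV₁) (realDiagonal_isSymm L dV₂ hdV₂)) hW
          (isUnit_det_finSum_realDiagonal L dV₁ dV₂ hdV₁ hdV₂ hdV₁0 hdV₂0) hWd
          (finSum_eq_map_finSum (Fp L) L N₁ N₂ (Matrix.diagonal dV₁) (Matrix.diagonal dV₂) (realDiagonal_map L dV₁ hdV₁).symm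
            (realDiagonal_map L dV₂ hdV₂).symm) hJW χW
          (isCompatible_chiSplittingSum L eV dV₁ hdV₁ hdV₁0 dV₂ hdV₂ hdV₂0 χ hχu hχs TW hW hWd JW hJW _ _ _)
          (finAdelicCastV (Fp L) L (IsCMField.complexConj L) (N₁ + N₂) (finSum_diagonal_append dV₁ dV₂).symm k)
        (appendCoinvEquiv L eV dV₁ hdV₁ hdV₁0 dV₂ hdV₂ hdV₂0 χ hχu hχs TW hW hWd JW hJW χW x) :=
  weilCoinvCongrV_weilCoinv (Fp L) L (IsCMField.complexConj L) (N₁ + N₂) 1 eV JW (complexConj_imagUnit L) (imagUnit_ne_zero L)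
    (imagUnit_mul_self L) hW hWd hJW _ _ _ _ _ _ _ _ _ _ χW k x

end AppendInstance

end Literature.NumberTheory.Automorphic.Liu2021.Def411WeilCarriersDoubling

end
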